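import Literature.Algebra.EuclideanLattices.MRFineGrid
import Mathlib.LinearAlgebra.FreeModule.Finite.Quotient
import Mathlib.GroupTheory.Index
import HarnessLib

/-!
# Choosing the fine grid from the lattice data: the index of `L(S)` in `Λ` and the grid basis `S/(q·d)`

Topic `Algebra/EuclideanLattices` (family `pqc`). Companion of `MRFineGrid.lean` and
`MRIncGDDIdealised.lean`, which take the fine-grid basis `b` (`sⱼ = M bⱼ`, `M = q·d`) and the
inclusions `sⱼ ∈ Λ ⊆ span_ℤ b` as data/hypotheses. Here they are produced from what the reduction of
Micciancio–Regev 2007, Thm. 5.9 / Lemma 5.10 actually holds — a full-rank lattice `Λ` and `n`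
linearly independent lattice vectors `S` — as the paper's "sufficiently fine grid" (p. 8) requires:

* `MicciancioRegev2007.linearIndependent_int`, `finrank_span_range` — `S` is `ℤ`-independent in `Λ`
  and `L(S) = span_ℤ S` has rank `n`;
* `MicciancioRegev2007.exists_nsmul_mem_span` — **`L(S)` has finite index in `Λ`**: some `d ≥ 1`
  (the index `[Λ : L(S)]`, by Mathlib's `Submodule.finiteQuotientOfFreeOfRankEq` and
  `AddSubgroup.nsmul_index_mem`) satisfies `d • x ∈ L(S)` for every `x ∈ Λ`;
* `MicciancioRegev2007.gridBasis S hS hn M` — the basis `bⱼ = M⁻¹ sⱼ` of `V`; `smul_gridBasis`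
  (`M bⱼ = sⱼ`), and `le_span_gridBasis` — for `M = q·d` with `d` as above, `Λ ⊆ span_ℤ b`
  (every lattice vector has `S`-coordinates in `(1/d)ℤ ⊆ (1/M)ℤ`);
* `MicciancioRegev2007.exists_gridClass_section` — representatives of the offset classes exist.

## References

* D. Micciancio, O. Regev, *Worst-case to average-case reductions based on Gaussian measures*,
  SIAM J. Comput. 37 (2007) 267–302; authors' version, p. 8 (grid convention), Lemma 5.8 (p. 21:
  lattice vectors modulo `P(S)`), Lemma 5.10 (p. 24: the sets `S ⊂ L(B)` of the iteration).
-/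

noncomputable section

open Finset Module Submodule

namespace Literature.Algebra.EuclideanLattices

namespace MicciancioRegev2007

variable {V : Type*} [NormedAddCommGroup V] [InnerProductSpace ℝ V] [FiniteDimensional ℝ V]
variable (Λ : Submodule ℤ V) [DiscreteTopology Λ] [IsZLattice ℝ Λ]
variable {n : ℕ} (S : Fin n → Λ)

/-! ### `L(S)` inside `Λ`: rank and finite index -/

omit [FiniteDimensional ℝ V] [DiscreteTopology Λ] [IsZLattice ℝ Λ] in
/-- Lattice vectors that are linearly independent over `ℝ` are linearly independent over `ℤ` inside
the lattice. [folklore] -/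
theorem linearIndependent_int (hS : LinearIndependent ℝ fun j => (S j : V)) : LinearIndependent ℤ S :=
  LinearIndependent.of_comp (Λ.subtype.restrictScalars ℤ)
    (by simpa [Function.comp_def] using hS.restrict_scalars' ℤ)

omit [FiniteDimensional ℝ V] [DiscreteTopology Λ] [IsZLattice ℝ Λ] in
/-- `L(S) = span_ℤ S` has rank `n`. [folklore] -/
theorem finrank_span_range (hS : LinearIndependent ℝ fun j => (S j : V)) :
    finrank ℤ (span ℤ (Set.range S)) = n := by
  rw [finrank_span_eq_card (linearIndependent_int Λ S hS), Fintype.card_fin]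

/-- **`L(S)` has finite index in `Λ`** when `S` consists of `n = dim V` linearly independent lattice
vectors: there is `d ≥ 1` with `d • x ∈ span_ℤ S` for all `x ∈ Λ` (namely the index `[Λ : L(S)]`).
[cite: MicciancioRegev2007, Lemma 5.8 (p. 21: "lattice vectors vᵢ ∈ L(B) mod P(S)", a finite group)] -/
theorem exists_nsmul_mem_span (hS : LinearIndependent ℝ fun j => (S j : V)) (hn : n = finrank ℝ V) :
    ∃ d : ℕ, d ≠ 0 ∧ ∀ x : Λ, d • x ∈ span ℤ (Set.range S) := by
  have hrank : finrank ℤ (span ℤ (Set.range S)) = finrank ℤ Λ := by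
    rw [finrank_span_range Λ S hS, ZLattice.rank ℝ Λ, hn]
  have hfin : Finite (Λ ⧸ span ℤ (Set.range S)) := Submodule.finiteQuotientOfFreeOfRankEq _ hrank
  refine ⟨(span ℤ (Set.range S)).toAddSubgroup.index, ?_, fun x => ?_⟩
  · have : Finite (Λ ⧸ (span ℤ (Set.range S)).toAddSubgroup) := hfin
    exact AddSubgroup.index_ne_zero_of_finite
  · exact AddSubgroup.nsmul_index_mem (span ℤ (Set.range S)).toAddSubgroup x

/-! ### The grid basis `bⱼ = sⱼ/M` -/

omit [FiniteDimensional ℝ V] [DiscreteTopology Λ] [IsZLattice ℝ Λ] in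
/-- The scaled family `M⁻¹ sⱼ` is linearly independent. [folklore] -/
theorem linearIndependent_inv_smul (hS : LinearIndependent ℝ fun j => (S j : V)) (M : ℕ) [NeZero M] :
    LinearIndependent ℝ fun j => (M : ℝ)⁻¹ • (S j : V) := by
  have hM : (M : ℝ)⁻¹ ≠ 0 := inv_ne_zero (by exact_mod_cast NeZero.ne M)
  have h := hS.units_smul fun _ => Units.mk0 _ hM
  convert h using 1
  funext j
  rw [Pi.smul_apply', Units.smul_mk0]

/-- **The fine-grid basis** `bⱼ = M⁻¹ sⱼ` of `V` (`n = dim V` linearly independent lattice vectors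
`sⱼ`, grid parameter `M`; MR07's "sufficiently fine grid", p. 8, on which `L' = span_ℤ b = L(S)/M`).
[cite: MicciancioRegev2007, §2 (p. 8, the grid convention) with Lemma 5.8] -/
def gridBasis (hS : LinearIndependent ℝ fun j => (S j : V)) (hn : n = finrank ℝ V) (M : ℕ) [NeZero M] :
    Basis (Fin n) ℝ V :=
  basisOfLinearIndependentOfCardEqFinrank' (fun j => (M : ℝ)⁻¹ • (S j : V))
    (linearIndependent_inv_smul Λ S hS M) (by rw [Fintype.card_fin, hn])

omit [DiscreteTopology Λ] [IsZLattice ℝ Λ] in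
/-- `bⱼ = M⁻¹ sⱼ`. [folklore] -/
@[simp]
theorem gridBasis_apply (hS : LinearIndependent ℝ fun j => (S j : V)) (hn : n = finrank ℝ V) (M : ℕ)
    [NeZero M] (j : Fin n) : gridBasis Λ S hS hn M j = (M : ℝ)⁻¹ • (S j : V) := by
  rw [gridBasis, coe_basisOfLinearIndependentOfCardEqFinrank']

omit [DiscreteTopology Λ] [IsZLattice ℝ Λ] in
/-- `M bⱼ = sⱼ`: the hypothesis `hSL` of `MRFineGrid`/`MRIncGDDIdealised` (`M bⱼ ∈ Λ`). [folklore] -/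
theorem smul_gridBasis (hS : LinearIndependent ℝ fun j => (S j : V)) (hn : n = finrank ℝ V) (M : ℕ)
    [NeZero M] (j : Fin n) : (M : ℝ) • gridBasis Λ S hS hn M j = S j := by
  rw [gridBasis_apply, smul_smul, mul_inv_cancel₀ (by exact_mod_cast NeZero.ne M), one_smul]

omit [DiscreteTopology Λ] [IsZLattice ℝ Λ] in
/-- `M bⱼ ∈ Λ`. [folklore] -/
theorem smul_gridBasis_mem (hS : LinearIndependent ℝ fun j => (S j : V)) (hn : n = finrank ℝ V) (M : ℕ)
    [NeZero M] (j : Fin n) : (M : ℝ) • gridBasis Λ S hS hn M j ∈ Λ := by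
  rw [smul_gridBasis]; exact (S j).2

omit [DiscreteTopology Λ] [IsZLattice ℝ Λ] in
/-- **`Λ ⊆ span_ℤ b` for `M = q·d` when `d • Λ ⊆ L(S)`**: the hypothesis `hLL'` of the idealised
reduction (every lattice vector has `S`-coordinates in `(1/d)ℤ ⊆ (1/M)ℤ`). [cite: MicciancioRegev2007, §2 (p. 8) with Lemma 5.8 (p. 21)] -/
theorem le_span_gridBasis (hS : LinearIndependent ℝ fun j => (S j : V)) (hn : n = finrank ℝ V)
    (q d : ℕ) [NeZero q] [NeZero d] (hd : ∀ x : Λ, d • x ∈ span ℤ (Set.range S)) :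
    Λ ≤ span ℤ (Set.range (gridBasis Λ S hS hn (q * d))) := by
  intro x hx
  obtain ⟨k, hk⟩ := (Submodule.mem_span_range_iff_exists_fun ℤ).1 (hd ⟨x, hx⟩)
  -- read the identity `∑ kⱼ sⱼ = d • x` in `V`
  have hV : ∑ j, (k j : ℝ) • (S j : V) = (d : ℝ) • x := by
    have h := congrArg (fun y : Λ => (y : V)) hk
    simp only [Submodule.coe_sum, Submodule.coe_smul_of_tower] at h
    simpa only [← Int.cast_smul_eq_zsmul ℝ, ← Nat.cast_smul_eq_nsmul ℝ] using h
  have hd0 : (d : ℝ) ≠ 0 := by exact_mod_cast NeZero.ne d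
  have hq0 : (q : ℝ) ≠ 0 := by exact_mod_cast NeZero.ne q
  have hx' : x = ∑ j, ((k j * q : ℤ) : ℝ) • gridBasis Λ S hS hn (q * d) j := by
    have hx1 : x = (d : ℝ)⁻¹ • ∑ j, (k j : ℝ) • (S j : V) := by
      rw [hV, smul_smul, inv_mul_cancel₀ hd0, one_smul]
    rw [hx1, Finset.smul_sum]
    refine Finset.sum_congr rfl fun j _ => ?_
    rw [gridBasis_apply, smul_smul, smul_smul]
    congr 1
    push_cast
    field_simp
  rw [hx']
  refine Submodule.sum_mem _ fun j _ => ?_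
  rw [Int.cast_smul_eq_zsmul]
  exact Submodule.smul_mem _ _ (subset_span (Set.mem_range_self j))

/-- **Representatives of the offset classes exist** (any section of the onto class map
`gridClass`; a machine picks a computable one). [folklore] -/
theorem exists_gridClass_section {W : Type*} [NormedAddCommGroup W] [NormedSpace ℝ W] {k : ℕ}
    (b : Basis (Fin k) ℝ W) (M : ℕ) [NeZero M] (L : Submodule ℤ W) :
    ∃ rep : (Fin k → ZMod M) ⧸ gridImage b M L → span ℤ (Set.range b),
      ∀ a, gridClass b M L (rep a) = a :=
  ⟨Function.surjInv (gridClass_surjective b M L), Function.surjInv_eq _⟩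

end MicciancioRegev2007

end Literature.Algebra.EuclideanLattices

end
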